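import Mathlib.Analysis.SpecialFunctions.SmoothTransition
import Summits.FinalStateConjecture.FinalStateConjecture.Theorems.PhaseMixingCaptureNearExtremalKappaCaptureThermalTimeStabilityCentre
import Literature.Geometry.Lorentzian.KerrConvergenceProofs
import HarnessLib

/-!
# Crux `ClusterCompleteness.OmegaLimitMultiKerr` (stmt-FinalStateConjecture-14664), line `Sketch` —
# N = 1 exact-Kerr certificate, part 1/3: the exactly isometric late chart of the Kerr slab
# development (registered stub `kerrSlab_exactChart`)

The crux's recurrence interface `Recurs k` is certified on the EXACT sub-extremal Kerr black hole,
realised as the vacuum Cauchy development `KerrSlab.development hM ha` (`0 < M`, `|a| < M`;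
`PhaseMixingCaptureNearExtremalKappaCaptureThermalTimeStabilityCentre.lean`) of the Kerr data on
the Kerr–Schild slice `{t* = 0, r > M}`: its carrier is the slab domain
`KerrSlab.domain a M = {x ∈ Kerr.region a M | 0 < x⁰ + (r x − M)/4}` and its metric is the
restricted Kerr metric, `g_p = Kerr.bilin M a p` definitionally. This file supplies the first of
three ingredients: a late chart

* `Ψ : Kerr.exterior M a → KerrSlab.development hM ha` on the Kerr reference background
  `Kerr.background M a = (Kerr.exterior M a, g_{M,a}, t* = x⁰, r)` (`KerrConvergence.lean`),

which is `C^∞`, an open embedding on the late region `Kerr.lateRegion M a 1 = {t* > 1}`, the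
identity in coordinates on `{t* ≥ 1}`, and whose extended metric deviation
`Spacetime.deviationExtend (Kerr.background M a) Ψ = Ψ^* g − g_{M,a}` (extended by `0` off the
exterior) vanishes together with ALL its derivatives at every point of `E4` with `x⁰ > 1`.

Construction: the time-bent identity `bend x = x + (θ(x⁰) − x⁰) ∂₀` of `E4` with the smooth bend
`θ t = 1 + S(t) (t − 1)` (`S = Real.smoothTransition`): `θ t = t` for `t ≥ 1`, `θ = 1` for
`t ≤ 0`, `θ ≥ 0` throughout. The spatial part is untouched, so `r(bend x) = r(x) > r₊ ≥ M` and
`(bend x)⁰ = θ(x⁰) ≥ 0`: `bend` maps the exterior into the slab domain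
(`KerrSlab.mem_domain_of_nonneg`). Smoothness of `Ψ` is smoothness of `bend` read through the
two open inclusions `slab ↪ Kerr.region a M ↪ E4` (`ContMDiffAt.subtypeVal_comp_iff`); on
`{t* > 1}` the map is the inclusion of an open subset (`IsOpenEmbedding.of_comp`); and there
`dΨ = id` (`hasMFDerivAt_subtypeVal`, `bend = id` near such points), so `Ψ^* g = g_{M,a}` and
the extended deviation vanishes identically on the open set `{x⁰ > 1} ⊆ E4` (on the exterior by
this computation, off it by the junk value `0`), hence so do all its `iteratedFDeriv`s.

No named fact is consumed; `[Kerr.Facts]`, `[Kerr.SliceFacts]` are the standing instance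
hypotheses of `Kerr.data` / `KerrSlab.development`.

References: M. Dafermos, I. Rodnianski, arXiv:0811.0354, §5.1 (ingoing Kerr–Schild coordinates,
the `{t* = τ}` foliation); J. Sbierski, Ann. Henri Poincaré 17 (2016), Def. 2.4 (developments
realised as open subsets); J. M. Lee, *Introduction to Smooth Manifolds* (2013), Prop. 3.9
(`T_p W = T_p N` for open `W ⊆ N`).
-/

-- every `Summit.FinalStateConjecture.FinalStateConjecture.…` name repeats the summit = sub-problem segment (D-0017 layout)
set_option linter.dupNamespace false

noncomputable section

open scoped Manifold ContDiff Topology ENNReal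
open Set Filter TopologicalSpace Function

namespace Summit.FinalStateConjecture.FinalStateConjecture.Theorems.ClusterCompleteness

open Literature.Geometry.Lorentzian
open Summit.FinalStateConjecture.FinalStateConjecture.Theorems.NearExtremalKappaCapture.UnitTemperatureFrontFace

/-! ## The time bend `θ t = 1 + S(t) (t − 1)` and the bent identity of `E4` -/

/-- The time bend `θ t = 1 + S(t) (t − 1)` (`S = Real.smoothTransition`) is smooth. [folklore] -/
private theorem contDiff_timeBend :
    ContDiff ℝ ∞ fun t : ℝ ↦ 1 + Real.smoothTransition t * (t - 1) :=
  contDiff_const.add (Real.smoothTransition.contDiff.mul (contDiff_id.sub contDiff_const))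

/-- The time bend is the identity on `[1, ∞)`. [folklore] -/
private theorem timeBend_of_one_le {t : ℝ} (h : 1 ≤ t) :
    1 + Real.smoothTransition t * (t - 1) = t := by
  rw [Real.smoothTransition.one_of_one_le h]
  ring

/-- The time bend is nonnegative (`θ = 1` on `t ≤ 0`, `θ ≥ t` on `[0, 1]`, `θ = t` on `t ≥ 1`).
[folklore] -/
private theorem timeBend_nonneg (t : ℝ) : 0 ≤ 1 + Real.smoothTransition t * (t - 1) := by
  rcases le_or_gt 1 t with h | h
  · rw [timeBend_of_one_le h]
    linarith
  · rcases le_or_gt 0 t with ht | ht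
    · have h0 := Real.smoothTransition.nonneg t
      have h1 := Real.smoothTransition.le_one t
      nlinarith [mul_nonneg h0 ht]
    · rw [Real.smoothTransition.zero_of_nonpos ht.le]
      linarith

/-- Time translation along `∂₀` shifts the time coordinate. [folklore] -/
private theorem add_smul_basisVector_zero_apply_zero (x : E4) (c : ℝ) :
    (x + c • E4.basisVector 0) 0 = x 0 + c := by
  simp

/-- Time translation along `∂₀` does not change the spatial part. [folklore] -/
private theorem spatial_add_smul_basisVector_zero (x : E4) (c : ℝ) :
    E4.spatial (x + c • E4.basisVector 0) = E4.spatial x := by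
  ext i
  simp [E4.spatial_apply]

/-- Time translation along `∂₀` does not change the Kerr–Schild radius (adapted from
`EIHFluxBalance.ModulatedKerrHandoff.radius_add_smul_basisVector_zero`). [folklore] -/
private theorem radius_add_smul_basisVector_zero (a : ℝ) (x : E4) (c : ℝ) :
    Kerr.radius a (x + c • E4.basisVector 0) = Kerr.radius a x :=
  Kerr.radius_eq_of_spatial_eq a (spatial_add_smul_basisVector_zero x c)

/-- The bent identity `bend x = x + (θ(x⁰) − x⁰) ∂₀` of `E4` is smooth. [folklore] -/
private theorem contDiff_bend :
    ContDiff ℝ ∞ fun x : E4 ↦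
      x + (1 + Real.smoothTransition (x 0) * (x 0 - 1) - x 0) • E4.basisVector 0 := by
  have h0 : ContDiff ℝ ∞ (fun x : E4 ↦ x 0) := (E4.dx 0).contDiff
  exact contDiff_id.add (((contDiff_timeBend.comp h0).sub h0).smul contDiff_const)

/-! ## The chart -/

/-- **STUB (chart).** An exactly isometric late chart of the Kerr slab development on the Kerr
background: a `C^∞` map `Ψ : Kerr.exterior M a → slab` which is an open embedding on the late region
`{t* > 1}`, is the identity in coordinates on `{t* ≥ 1}`, and whose extended metric deviation from
`g_{M,a}` vanishes with all derivatives at every point of `E4` with `x⁰ > 1`. [folklore] -/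
theorem kerrSlab_exactChart : ∀ [Kerr.Facts] [Kerr.SliceFacts] {M a : ℝ} (hM : 0 < M) (ha : |a| < M),
    ∃ Ψ : (Kerr.background M a).domain → (KerrSlab.development hM ha).carrier,
      ContMDiff 𝓘(ℝ, E4) (𝓡 4) ∞ Ψ ∧
      Topology.IsOpenEmbedding ((Kerr.lateRegion M a 1).restrict Ψ) ∧
      (∀ x : (Kerr.background M a).domain, 1 ≤ x.1 0 → (Ψ x).1.1 = x.1) ∧
      ∀ z : E4, 1 < z 0 → ∀ m : ℕ,
        iteratedFDeriv ℝ m ((KerrSlab.development hM ha).toSpacetime.deviationExtend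
          (Kerr.background M a) Ψ) z = 0 := by
  intro _ _ M a hM ha
  -- the bent identity of `E4`
  let bend : E4 → E4 := fun x ↦
    x + (1 + Real.smoothTransition (x 0) * (x 0 - 1) - x 0) • E4.basisVector 0
  have hbend0 : ∀ x : E4, bend x 0 = 1 + Real.smoothTransition (x 0) * (x 0 - 1) := fun x ↦
    (add_smul_basisVector_zero_apply_zero x _).trans (add_sub_cancel _ _)
  have hrad : ∀ x : E4, Kerr.radius a (bend x) = Kerr.radius a x := fun x ↦
    radius_add_smul_basisVector_zero a x _
  have hbend_id : ∀ x : E4, 1 ≤ x 0 → bend x = x := fun x hx ↦ by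
    change x + (1 + Real.smoothTransition (x 0) * (x 0 - 1) - x 0) • E4.basisVector 0 = x
    rw [timeBend_of_one_le hx, sub_self, zero_smul, add_zero]
  -- `bend` maps the exterior into the slab domain
  have hMr : M ≤ Kerr.rPlus M a := le_add_of_nonneg_right (Real.sqrt_nonneg _)
  have hreg : ∀ x : (Kerr.background M a).domain, bend x.1 ∈ Kerr.region a M := fun x ↦ by
    refine Kerr.region_mono a hMr ?_
    change bend x.1 ∈ Kerr.exterior M a
    rw [Kerr.mem_exterior, hrad]
    exact Kerr.mem_exterior.1 x.2
  have hdom : ∀ x : (Kerr.background M a).domain,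
      (⟨bend x.1, hreg x⟩ : Kerr.region a M) ∈ KerrSlab.domain a M := fun x ↦
    KerrSlab.mem_domain_of_nonneg (by
      change 0 ≤ bend x.1 0
      rw [hbend0]
      exact timeBend_nonneg _)
  -- the chart
  let Ψ : (Kerr.background M a).domain → (KerrSlab.development hM ha).carrier := fun x ↦
    ⟨⟨bend x.1, hreg x⟩, hdom x⟩
  have h0c : Continuous fun z : E4 ↦ z 0 := PiLp.continuous_apply 2 _ 0
  -- smoothness, read through the two open inclusions `slab ↪ Kerr.region a M ↪ E4`
  have hΨs : ContMDiff 𝓘(ℝ, E4) (𝓡 4) ∞ Ψ := fun x ↦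
    (ContMDiffAt.subtypeVal_comp_iff (KerrSlab.domain a M) Ψ x).1
      ((ContMDiffAt.subtypeVal_comp_iff (Kerr.region a M) (Subtype.val ∘ Ψ) x).1
        ((contDiff_bend.contMDiff.comp contMDiff_subtype_val) x))
  -- on `{t* > 1}` the differential of `Ψ` is the identity
  have hmf : ∀ x : (Kerr.background M a).domain, 1 < x.1 0 →
      mfderiv 𝓘(ℝ, E4) (𝓡 4) Ψ x = ContinuousLinearMap.id ℝ E4 := by
    intro x hx
    have hΨx : HasMFDerivAt 𝓘(ℝ, E4) (𝓡 4) Ψ x (mfderiv 𝓘(ℝ, E4) (𝓡 4) Ψ x) :=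
      ((hΨs x).mdifferentiableAt (by simp)).hasMFDerivAt
    have hv1 : HasMFDerivAt (𝓡 4) (𝓡 4)
        (Subtype.val : (KerrSlab.development hM ha).carrier → Kerr.region a M) (Ψ x)
        (ContinuousLinearMap.id ℝ E4) := hasMFDerivAt_subtypeVal (W := KerrSlab.domain a M) (Ψ x)
    have hv2 : HasMFDerivAt (𝓡 4) 𝓘(ℝ, E4) (Subtype.val : Kerr.region a M → E4) (Ψ x).1
        (ContinuousLinearMap.id ℝ E4) := hasMFDerivAt_subtypeVal (Ψ x).1
    -- `d(val ∘ val ∘ Ψ)_x = id ∘ id ∘ dΨ_x`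
    have h12 := hv2.comp (Ψ x) hv1
    have hcomp := h12.comp x hΨx
    -- `val ∘ val ∘ Ψ = bend ∘ val` agrees with `val` near `x`, so its differential is `id`
    have hid : HasMFDerivAt 𝓘(ℝ, E4) 𝓘(ℝ, E4) (fun y : (Kerr.background M a).domain ↦ bend y.1) x
        (ContinuousLinearMap.id ℝ E4) := by
      refine (hasMFDerivAt_subtypeVal x).congr_of_eventuallyEq ?_
      have hopen : IsOpen {y : (Kerr.background M a).domain | 1 < y.1 0} :=
        isOpen_lt continuous_const (h0c.comp continuous_subtype_val)
      filter_upwards [hopen.mem_nhds hx] with y hy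
      exact hbend_id y.1 hy.le
    have huniq := hasMFDerivAt_unique hcomp hid
    exact ContinuousLinearMap.ext fun v ↦ DFunLike.congr_fun huniq v
  -- hence the deviation vanishes on `{t* > 1}`
  have hdev : ∀ x : (Kerr.background M a).domain, 1 < x.1 0 →
      (KerrSlab.development hM ha).toSpacetime.deviation (Kerr.background M a) Ψ x = 0 := by
    intro x hx
    ext v w
    rw [Spacetime.deviation_apply, hmf x hx, zero_apply, zero_apply]
    change Kerr.bilin M a (bend x.1) v w - Kerr.bilin M a x.1 v w = 0
    rw [hbend_id x.1 hx.le, sub_self]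
  refine ⟨Ψ, hΨs, ?_, fun x hx ↦ hbend_id x.1 hx, fun z hz m ↦ ?_⟩
  · -- open embedding on `{t* > 1}`: there `Ψ` is the inclusion of an open subset
    have hL : IsOpen (Kerr.lateRegion M a 1) :=
      isOpen_lt continuous_const (h0c.comp continuous_subtype_val)
    have hg : Topology.IsOpenEmbedding
        (fun p : (KerrSlab.development hM ha).carrier ↦ (p.1.1 : E4)) :=
      (Kerr.region a M).2.isOpenEmbedding_subtypeVal.comp
        (KerrSlab.domain a M).2.isOpenEmbedding_subtypeVal
    have hgf : Topology.IsOpenEmbedding (fun y : Kerr.lateRegion M a 1 ↦ (y.1.1 : E4)) :=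
      (Kerr.exterior M a).2.isOpenEmbedding_subtypeVal.comp hL.isOpenEmbedding_subtypeVal
    have hfun : (fun p : (KerrSlab.development hM ha).carrier ↦ (p.1.1 : E4)) ∘
        (Kerr.lateRegion M a 1).restrict Ψ = fun y : Kerr.lateRegion M a 1 ↦ (y.1.1 : E4) :=
      funext fun y ↦ hbend_id y.1.1 (Kerr.mem_lateRegion.1 y.2).le
    exact Topology.IsOpenEmbedding.of_comp _ hg (hfun ▸ hgf)
  · -- the extended deviation vanishes identically near `z`, hence so do all its derivatives
    have hloc : (KerrSlab.development hM ha).toSpacetime.deviationExtend (Kerr.background M a) Ψ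
        =ᶠ[𝓝 z] fun _ ↦ 0 := by
      filter_upwards [(isOpen_lt continuous_const h0c).mem_nhds hz] with z' hz'
      by_cases hz'e : z' ∈ (Kerr.background M a).domain
      · exact (Spacetime.deviationExtend_coe _ (Kerr.background M a) Ψ ⟨z', hz'e⟩).trans
          (hdev ⟨z', hz'e⟩ hz')
      · exact Spacetime.deviationExtend_of_not_mem _ (Kerr.background M a) Ψ hz'e
    rw [(Filter.EventuallyEq.iteratedFDeriv ℝ hloc m).eq_of_nhds, iteratedFDeriv_fun_zero]
    rfl

end Summit.FinalStateConjecture.FinalStateConjecture.Theorems.ClusterCompleteness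

end
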